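import Summits.NavierStokesRegularity.NavierStokesRegularity.Theorems.TypeIliouvilleNoTypeII.Negative.NSISuperCascadeEulerScaling
import Literature.Analysis.FluidPDE.LocalPressureOscillation
import HarnessLib

/-!
# The super-similar NSI cascade satisfies Seregin's power-weighted gauges `r^{2ρ} A`, `r^{ρ} E`

Negative-lane support file for `stmt-NavierStokesRegularity-0056` (kill-kit, model class M2′),
bearing on the §B route `EulerZoomLiouville`: its items `TypeIOrPowerZoomable` /
`SereginZoomReduction` describe a Type-II candidate at `z₀` by the POWER-GAUGE bound
`sup_{0<r≤r₀} (r^{2ρ} A(r) + r^{ρ} E(r) + r^{2ρ} D(r)) ≤ M` (Seregin, arXiv:2402.13229, (1.7)–(1.8))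
and the `L³` floor (3.1); the crux `PowerGaugeEulerLiouville` is the Liouville theorem killing its
Euler zoom limit. Here we check, in the kernel, that the super-similar NSI cascade
`𝔲 = glueG T σ τ a z u` of an `IsSuperBlock` datum with power exponent `ρ` (`a = τ^{-(1+ρ)}`,
`NSISuperCascadeEulerScaling`) obeys the first two gauge bounds AT EVERY CENTRE AND EVERY SCALE:

* `exists_lintegral_ball_norm_sq_glueG_le` — `∫_{B(x',r)} |𝔲(t)|² ≤ C r^{1-2ρ}` for all `t, x', r`;
  hence `exists_powerGaugeA_le` — `r^{2ρ} · cknA r z₀ 𝔲 ≤ C` for all `z₀`, `r > 0`;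
* `exists_lintegral_cylinder_frobeniusNormSq_le` — `∫∫_{ℝ × B(x',r)} |D𝔲|² ≤ C r^{1-ρ}`; hence
  `exists_powerGaugeE_le` — `r^{ρ} · cknE r z₀ D𝔲 ≤ C` for all `z₀`, `r > 0`
  (`D𝔲` the slice derivative, the weak spatial gradient of `NSISuperCascadeWeak`).

Mechanism (the two-regime lemma `crossover_tsum_le`): on the `j`-th strip the field is `aʲ u ∘ Φ_j`
on a ball of radius `≍ τʲ` for a time `T σ^{2j}`; pieces larger than `r` are counted by
volume × `sup²` (`aʲ`, resp. `aʲτ^{-j}` for `D𝔲`), smaller ones by their total (strip) integral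
(`(a²τ³)ʲ = (τʲ)^{1-2ρ}`, resp. `(aτ²)ʲ = (τʲ)^{1-ρ}`); the dictionary of
`NSISuperCascadeEulerScaling` makes both branches meet exactly at Seregin's weights. The `D`-gauge
(pressure, `‖p̃[u(s)]‖_{L^q}` for some `q > 9/2` by Calderón–Zygmund) follows the same count and is
not treated here.

WHAT THIS IS NOT: nothing about Navier–Stokes or Euler solutions — `𝔲` solves the NS INEQUALITY only.
Kill-kit reading (K3, by name): the power-gauge hypotheses (1.7) of the route's items do not
separate NS blow-ups from the NSI cascade; whatever excludes the power-zoomable Type-II portrait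
must use the identity. No new definitions.

References: Seregin, arXiv:2402.13229 (2024), (1.7)–(1.8); arXiv:2409.07625 (2024), Thm. 1.3;
Ożański, arXiv:1709.00602 (2017), §2 [`Ozanski2017NSISingular`]; Caffarelli–Kohn–Nirenberg 1982,
(2.1)–(2.5) (the gauges `A`, `E`).
-/

noncomputable section

open MeasureTheory Set Function Filter Topology Metric Module
open scoped ENNReal

set_option linter.dupNamespace false

namespace Summit.NavierStokesRegularity.NavierStokesRegularity.Theorems.TypeIliouvilleNoTypeIINegative

open Literature.Analysis.FluidPDE Literature.Barriers.NavierStokesRegularity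
open Literature.Barriers.NavierStokesRegularity.Scheffer

namespace IsSuperBlock

variable {T ν₀ τ σ a : ℝ} {z : EuclideanSpace ℝ (Fin 3)} {G : Set (EuclideanSpace ℝ (Fin 3))}
  {u : ℝ → EuclideanSpace ℝ (Fin 3) → EuclideanSpace ℝ (Fin 3)} {ρ : ℝ}

/-! ### Pointwise sizes on the strips -/

/-- A uniform bound for `|Du|²` on `[0,T] × ℝ³` (continuity on the compact `[0,T] × G`,
vanishing off `G`). [folklore] -/
theorem exists_bound_frobeniusNormSq (h : IsSuperBlock T ν₀ τ σ a z G u) :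
    ∃ M : ℝ, 0 ≤ M ∧ ∀ t ∈ Icc 0 T, ∀ x, frobeniusNormSq (fderiv ℝ (u t) x) ≤ M := by
  obtain ⟨M, hM⟩ := (isCompact_Icc.prod h.isCompact).exists_bound_of_continuousOn
    ((LerayHopfProofs.continuous_frobeniusNormSq.comp_continuousOn
      h.block.continuousOn_fderiv_slice).mono (prod_mono Subset.rfl (subset_univ _)))
  refine ⟨max M 0, le_max_right _ _, fun t ht x => ?_⟩
  by_cases hx : x ∈ G
  · have h1 := hM (t, x) (mk_mem_prod ht hx)
    rw [Function.comp_apply, Real.norm_of_nonneg (frobeniusNormSq_nonneg _)] at h1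
    exact h1.trans (le_max_left _ _)
  · rw [h.block.fderiv_slice_eq_zero_of_notMem ht hx, frobeniusNormSq_zero]
    exact le_max_right _ _

/-- **Size of the `j`-th piece**: `‖𝔲(t,x)‖ ≤ aʲ sup|u|` on the `j`-th strip.
[cite: Ozanski2017NSISingular, §2.1 (p. 6)] -/
theorem norm_glueG_le_of_mem (h : IsSuperBlock T ν₀ τ σ a z G u) {M₀ : ℝ}
    (hM₀ : ∀ s ∈ Icc 0 T, ∀ y, ‖u s y‖ ≤ M₀) {t : ℝ} {j : ℕ}
    (hj : t ∈ Ico (switchTime T σ j) (switchTime T σ (j + 1))) (x : EuclideanSpace ℝ (Fin 3)) :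
    ‖glueG T σ τ a z u t x‖ ≤ a ^ j * M₀ := by
  rw [glueG_eq_pieceG h.T_pos h.σ_pos τ a z u hj, pieceG_apply, norm_smul,
    Real.norm_of_nonneg (h.gain_pow_pos j).le]
  exact mul_le_mul_of_nonneg_left
    (hM₀ _ (localTime_mem_Icc h.σ_pos (Ico_subset_Icc_self hj)) _) (h.gain_pow_pos j).le

/-- **Size of the derivative of the `j`-th piece**: `|D𝔲(t,x)|² ≤ (aʲτ^{-j})² sup|Du|²` on the
`j`-th strip. [folklore] -/
theorem frobeniusNormSq_fderiv_glueG_le_of_mem (h : IsSuperBlock T ν₀ τ σ a z G u) {M₁ : ℝ}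
    (hM₁ : ∀ s ∈ Icc 0 T, ∀ y, frobeniusNormSq (fderiv ℝ (u s) y) ≤ M₁) {t : ℝ} {j : ℕ}
    (hj : t ∈ Ico (switchTime T σ j) (switchTime T σ (j + 1))) (x : EuclideanSpace ℝ (Fin 3)) :
    frobeniusNormSq (fderiv ℝ (glueG T σ τ a z u t) x) ≤ (a ^ j * (τ⁻¹) ^ j) ^ 2 * M₁ := by
  rw [h.fderiv_glueG_eq_smul_stPull hj x, Pi.smul_apply, Pi.smul_apply, stPull_apply,
    frobeniusNormSq_smul]
  exact mul_le_mul_of_nonneg_left (hM₁ _ (h.localTime_mem (Ico_subset_Icc_self hj)) _) (sq_nonneg _)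

/-! ### Volumes -/

/-- `|B(0,1)| < ∞`. [folklore] -/
theorem volume_unitBall_ne_top : volume (ball (0 : EuclideanSpace ℝ (Fin 3)) 1) ≠ ⊤ :=
  measure_ball_lt_top.ne

/-! ### The `A`-gauge: `∫_{B(x',r)} |𝔲(t)|² ≤ C r^{1-2ρ}` -/

/-- **Local energy of the cascade in Seregin's class**: there is `C` with
`∫_{B(x',r)} |𝔲(t)|² ≤ C r^{1-2ρ}` for every time `t`, centre `x'` and radius `r > 0`. On the
`j`-th strip: either `τʲ ≤ r` and the whole slice energy `(a²τ³)ʲ E₀ = (τʲ)^{1-2ρ} E₀ ≤ r^{1-2ρ}E₀`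
bounds it, or `r < τʲ` and `|B_r| (aʲ sup|u|)² = C r³ (τʲ)^{-(2+2ρ)} ≤ C r^{1-2ρ}` does
(`crossover_min_le`). [folklore] -/
theorem exists_lintegral_ball_norm_sq_glueG_le (h : IsSuperBlock T ν₀ τ σ a z G u)
    (hρ : a = τ ^ (-(1 + ρ))) :
    ∃ C : ℝ, 0 ≤ C ∧ ∀ (t : ℝ) (x' : EuclideanSpace ℝ (Fin 3)) (r : ℝ), 0 < r →
      ∫⁻ x in ball x' r, ‖glueG T σ τ a z u t x‖ₑ ^ 2 ≤ ENNReal.ofReal (C * r ^ (1 - 2 * ρ)) := by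
  obtain ⟨M₀, hM₀0, hM₀⟩ := h.block.exists_bound_norm
  have hρ0 := h.powerExp_pos hρ
  have hρ1 := h.powerExp_lt_half hρ
  have hτ := h.τ_pos
  -- the constants
  set E₀ : ℝ := ∫ y, ‖u 0 y‖ ^ 2 with hE₀
  have hE₀0 : 0 ≤ E₀ := integral_nonneg fun y => sq_nonneg _
  set V₁ : ℝ := (volume (ball (0 : EuclideanSpace ℝ (Fin 3)) 1)).toReal with hV₁
  have hV₁0 : 0 ≤ V₁ := ENNReal.toReal_nonneg
  refine ⟨E₀ + M₀ ^ 2 * V₁, by positivity, fun t x' r hr => ?_⟩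
  by_cases ht : t ∈ Ico 0 (blowupTime T σ)
  · obtain ⟨j, hj⟩ := exists_mem_Ico_switchTime h.σ_pos h.σ_lt_one ht.1 ht.2
    have hs : 0 < τ ^ j := pow_pos hτ j
    -- branch 1: total slice energy
    have h1 : ∫⁻ x in ball x' r, ‖glueG T σ τ a z u t x‖ₑ ^ 2 ≤
        ENNReal.ofReal (E₀ * (τ ^ j) ^ (1 - 2 * ρ)) := by
      calc ∫⁻ x in ball x' r, ‖glueG T σ τ a z u t x‖ₑ ^ 2
          ≤ ∫⁻ x, ‖glueG T σ τ a z u t x‖ₑ ^ 2 := setLIntegral_le_lintegral _ _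
        _ ≤ ENNReal.ofReal ((a ^ 2 * τ ^ 3) ^ j) * ∫⁻ y, ‖u 0 y‖ₑ ^ 2 :=
            h.lintegral_norm_sq_glueG_le hj
        _ = ENNReal.ofReal (E₀ * (τ ^ j) ^ (1 - 2 * ρ)) := by
            rw [nsiBlock_lintegral_enorm_sq_eq h.block ⟨le_rfl, h.T_pos.le⟩, ← hE₀,
              ← ENNReal.ofReal_mul (pow_nonneg h.energyRatio_nonneg _), h.energyRatio_eq_rpow hρ,
              ← pow_rpow_comm hτ.le, mul_comm]
    -- branch 2: volume × sup²
    have h2 : ∫⁻ x in ball x' r, ‖glueG T σ τ a z u t x‖ₑ ^ 2 ≤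
        ENNReal.ofReal (M₀ ^ 2 * V₁ * (r ^ ((1 - 2 * ρ) + (2 + 2 * ρ)) * (τ ^ j) ^ (-(2 + 2 * ρ)))) := by
      have hpt : ∀ x ∈ ball x' r, ‖glueG T σ τ a z u t x‖ₑ ^ 2 ≤ ENNReal.ofReal ((a ^ j * M₀) ^ 2) := by
        intro x _
        rw [← ofReal_norm, ← ENNReal.ofReal_pow (norm_nonneg _)]
        exact ENNReal.ofReal_le_ofReal
          (pow_le_pow_left₀ (norm_nonneg _) (h.norm_glueG_le_of_mem hM₀ hj x) 2)
      have hr3 : r ^ ((1 - 2 * ρ) + (2 + 2 * ρ)) = r ^ 3 := by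
        rw [show (1 - 2 * ρ) + (2 + 2 * ρ) = ((3 : ℕ) : ℝ) by push_cast; ring, Real.rpow_natCast]
      have haj : (a ^ j) ^ 2 = (τ ^ j) ^ (-(2 + 2 * ρ)) := by
        rw [h.gain_pow_eq_rpow hρ, ← Real.rpow_mul_natCast hs.le]
        congr 1; push_cast; ring
      calc ∫⁻ x in ball x' r, ‖glueG T σ τ a z u t x‖ₑ ^ 2
          ≤ ∫⁻ x in ball x' r, ENNReal.ofReal ((a ^ j * M₀) ^ 2) := setLIntegral_mono' measurableSet_ball hpt
        _ = ENNReal.ofReal ((a ^ j * M₀) ^ 2) * volume (ball x' r) := setLIntegral_const _ _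
        _ = ENNReal.ofReal (M₀ ^ 2 * V₁ * (r ^ ((1 - 2 * ρ) + (2 + 2 * ρ)) * (τ ^ j) ^ (-(2 + 2 * ρ)))) := by
            rw [volume_ball_eq_ofReal_mul x' hr.le, ← ENNReal.ofReal_toReal volume_unitBall_ne_top, ← hV₁,
              ← ENNReal.ofReal_mul (pow_nonneg hr.le 3), ← ENNReal.ofReal_mul (by positivity), hr3,
              mul_pow, haj]
            congr 1; ring
    -- crossover
    calc ∫⁻ x in ball x' r, ‖glueG T σ τ a z u t x‖ₑ ^ 2
        ≤ ENNReal.ofReal (min (E₀ * (τ ^ j) ^ (1 - 2 * ρ))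
            (M₀ ^ 2 * V₁ * (r ^ ((1 - 2 * ρ) + (2 + 2 * ρ)) * (τ ^ j) ^ (-(2 + 2 * ρ))))) := by
          rw [ENNReal.ofReal_min]; exact le_min h1 h2
      _ ≤ ENNReal.ofReal ((E₀ + M₀ ^ 2 * V₁) * r ^ (1 - 2 * ρ)) :=
          ENNReal.ofReal_le_ofReal (crossover_min_le hs hr (by linarith) (by linarith) hE₀0
            (by positivity))
  · rw [h.glueG_eq_zero_of_notMem ht]
    simp

/-- **The power-weighted `A`-gauge of the cascade is bounded at every centre and scale**:
`r^{2ρ} · A(r; z₀) ≤ C` with `A = cknA` (`sup_t r⁻¹ ∫_{B_r} |𝔲|²`) — Seregin's first gauge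
(arXiv:2402.13229, (1.7)) for the NSI cascade. [folklore] -/
theorem exists_powerGaugeA_le (h : IsSuperBlock T ν₀ τ σ a z G u) (hρ : a = τ ^ (-(1 + ρ))) :
    ∃ C : ℝ, 0 ≤ C ∧ ∀ (z₀ : ℝ × EuclideanSpace ℝ (Fin 3)) (r : ℝ), 0 < r →
      ENNReal.ofReal (r ^ (2 * ρ)) * cknA r z₀ (glueG T σ τ a z u) ≤ ENNReal.ofReal C := by
  obtain ⟨C, hC0, hC⟩ := h.exists_lintegral_ball_norm_sq_glueG_le hρ
  refine ⟨C, hC0, fun z₀ r hr => ?_⟩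
  have hsup : cknA r z₀ (glueG T σ τ a z u) ≤ (ENNReal.ofReal r)⁻¹ * ENNReal.ofReal (C * r ^ (1 - 2 * ρ)) :=
    iSup₂_le fun t _ => mul_le_mul' le_rfl (hC t z₀.2 r hr)
  calc ENNReal.ofReal (r ^ (2 * ρ)) * cknA r z₀ (glueG T σ τ a z u)
      ≤ ENNReal.ofReal (r ^ (2 * ρ)) * ((ENNReal.ofReal r)⁻¹ * ENNReal.ofReal (C * r ^ (1 - 2 * ρ))) :=
        mul_le_mul' le_rfl hsup
    _ = ENNReal.ofReal (r ^ (2 * ρ) * (r⁻¹ * (C * r ^ (1 - 2 * ρ)))) := by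
        rw [← ENNReal.ofReal_inv_of_pos hr, ← ENNReal.ofReal_mul (inv_pos.2 hr).le,
          ← ENNReal.ofReal_mul (by positivity)]
    _ = ENNReal.ofReal C := by
        congr 1
        rw [show r ^ (2 * ρ) * (r⁻¹ * (C * r ^ (1 - 2 * ρ))) = C * (r ^ (2 * ρ) * r ^ (1 - 2 * ρ) * r⁻¹)
          by ring, ← Real.rpow_add hr, ← Real.rpow_neg_one, ← Real.rpow_add hr]
        norm_num

/-! ### The `E`-gauge: `∫∫_{ℝ × B(x',r)} |D𝔲|² ≤ C r^{1-ρ}` -/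

/-- **Dissipation of the cascade near a point, in Seregin's class**: there is `C` with
`∫⁻_{ℝ × B(x',r)} |D𝔲|² ≤ C r^{1-ρ}` for every centre `x'` and radius `r > 0`: the integral is the
sum over the strips (`lintegral_eq_tsum_strip`); the `j`-th strip contributes at most its total
`(aτ²)ʲ Z = (τʲ)^{1-ρ} Z` and at most `T σ^{2j} |B_r| (aʲτ^{-j})² sup|Du|² = C r³ (τʲ)^{-(2+ρ)}`, and
`crossover_tsum_le` sums the two regimes. [folklore] -/
theorem exists_lintegral_cylinder_frobeniusNormSq_le (h : IsSuperBlock T ν₀ τ σ a z G u)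
    (hρ : a = τ ^ (-(1 + ρ))) :
    ∃ C : ℝ, 0 ≤ C ∧ ∀ (x' : EuclideanSpace ℝ (Fin 3)) (r : ℝ), 0 < r →
      ∫⁻ q in (univ : Set ℝ) ×ˢ ball x' r,
          ENNReal.ofReal (frobeniusNormSq (fderiv ℝ (glueG T σ τ a z u q.1) q.2)) ≤
        ENNReal.ofReal (C * r ^ (1 - ρ)) := by
  obtain ⟨M₁, hM₁0, hM₁⟩ := h.exists_bound_frobeniusNormSq
  have hρ0 := h.powerExp_pos hρ
  have hρ1 := h.powerExp_lt_half hρ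
  have hτ := h.τ_pos
  have hτ1 := h.τ_lt_one
  -- the constants
  set Z : ℝ := (∫⁻ q in Ico 0 T ×ˢ (univ : Set (EuclideanSpace ℝ (Fin 3))),
    ENNReal.ofReal (frobeniusNormSq (fderiv ℝ (u q.1) q.2))).toReal with hZ
  have hZ0 : 0 ≤ Z := ENNReal.toReal_nonneg
  have hZeq : ∫⁻ q in Ico 0 T ×ˢ (univ : Set (EuclideanSpace ℝ (Fin 3))),
      ENNReal.ofReal (frobeniusNormSq (fderiv ℝ (u q.1) q.2)) = ENNReal.ofReal Z :=
    (ENNReal.ofReal_toReal h.block.base_lt_top_frobeniusNormSq.ne).symm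
  set V₁ : ℝ := (volume (ball (0 : EuclideanSpace ℝ (Fin 3)) 1)).toReal with hV₁
  have hV₁0 : 0 ≤ V₁ := ENNReal.toReal_nonneg
  set F : ℝ × EuclideanSpace ℝ (Fin 3) → ℝ≥0∞ := fun q =>
    ENNReal.ofReal (frobeniusNormSq (fderiv ℝ (glueG T σ τ a z u q.1) q.2)) with hF
  refine ⟨Z / (1 - τ ^ (1 - ρ)) + M₁ * T * V₁ / (1 - τ ^ (2 + ρ)), ?_, fun x' r hr => ?_⟩
  · have h1 : τ ^ (1 - ρ) < 1 := Real.rpow_lt_one hτ.le hτ1 (by linarith)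
    have h2 : τ ^ (2 + ρ) < 1 := Real.rpow_lt_one hτ.le hτ1 (by linarith)
    have := h.T_pos
    exact add_nonneg (div_nonneg hZ0 (by linarith)) (div_nonneg (by positivity) (by linarith))
  -- decomposition into strips
  have hmeas : MeasurableSet ((univ : Set ℝ) ×ˢ ball x' r) := MeasurableSet.univ.prod measurableSet_ball
  have hH0 : ∀ q : ℝ × EuclideanSpace ℝ (Fin 3), q.1 ∉ Ico 0 (blowupTime T σ) →
      ((univ : Set ℝ) ×ˢ ball x' r).indicator F q = 0 := fun q hq =>
    indicator_apply_eq_zero.2 fun _ => by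
      simp only [hF, h.fderiv_glueG_eq_zero_of_notMem hq q.2, frobeniusNormSq_zero, ENNReal.ofReal_zero]
  have hsplit : ∫⁻ q in (univ : Set ℝ) ×ˢ ball x' r, F q =
      ∑' j : ℕ, ∫⁻ q in Ico (switchTime T σ j) (switchTime T σ (j + 1)) ×ˢ ball x' r, F q := by
    rw [← lintegral_indicator hmeas, h.lintegral_eq_tsum_strip hH0]
    refine tsum_congr fun j => ?_
    rw [lintegral_indicator hmeas, Measure.restrict_restrict hmeas, prod_inter_prod, univ_inter,
      inter_univ]
  rw [hsplit]
  refine crossover_tsum_le (e₁ := 1 - ρ) (e₂ := 2 + ρ) hτ hτ1 hr (by linarith) (by linarith) hZ0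
    (by have := h.T_pos; positivity) (fun j => ?_) (fun j => ?_)
  · -- branch 1: the whole strip
    calc ∫⁻ q in Ico (switchTime T σ j) (switchTime T σ (j + 1)) ×ˢ ball x' r, F q
        ≤ ∫⁻ q in Ico (switchTime T σ j) (switchTime T σ (j + 1)) ×ˢ (univ : Set (EuclideanSpace ℝ (Fin 3))), F q :=
          lintegral_mono_set (prod_mono Subset.rfl (subset_univ _))
      _ = ENNReal.ofReal (Z * (τ ^ j) ^ (1 - ρ)) := by
          rw [hF, h.setLIntegral_strip_frobeniusNormSq_glueG j, hZeq,
            ← ENNReal.ofReal_mul (pow_nonneg (mul_nonneg h.gain_pos.le (sq_nonneg τ)) _),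
            h.gain_mul_sq_eq_rpow hρ, ← pow_rpow_comm hτ.le, mul_comm]
  · -- branch 2: volume × sup
    have hj' : ∀ q ∈ Ico (switchTime T σ j) (switchTime T σ (j + 1)) ×ˢ ball x' r,
        F q ≤ ENNReal.ofReal ((a ^ j * (τ⁻¹) ^ j) ^ 2 * M₁) := fun q hq =>
      ENNReal.ofReal_le_ofReal (h.frobeniusNormSq_fderiv_glueG_le_of_mem hM₁ (mem_prod.1 hq).1 q.2)
    have hvol : volume (Ico (switchTime T σ j) (switchTime T σ (j + 1)) ×ˢ ball x' r) =
        ENNReal.ofReal (T * σ ^ (2 * j)) * (ENNReal.ofReal (r ^ 3) * ENNReal.ofReal V₁) := by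
      rw [Measure.volume_eq_prod, Measure.prod_prod, Real.volume_Ico, switchTime_succ,
        add_sub_cancel_left, volume_ball_eq_ofReal_mul x' hr.le, hV₁, ENNReal.ofReal_toReal volume_unitBall_ne_top]
    have hr3 : r ^ ((1 - ρ) + (2 + ρ)) = r ^ 3 := by
      rw [show (1 - ρ) + (2 + ρ) = ((3 : ℕ) : ℝ) by push_cast; ring, Real.rpow_natCast]
    have hcoef : (a ^ j * (τ⁻¹) ^ j) ^ 2 * σ ^ (2 * j) = (τ ^ j) ^ (-(2 + ρ)) := by
      have ha : a ≠ 0 := h.gain_pos.ne'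
      have hτ0 : τ ≠ 0 := hτ.ne'
      rw [pow_mul, h.σ_sq, pow_rpow_comm hτ.le, ← h.gain_mul_inv_eq_rpow hρ, ← mul_pow, sq,
        mul_assoc, ← mul_pow, show a * τ⁻¹ * (τ / a) = 1 by field_simp, one_pow, mul_one]
    calc ∫⁻ q in Ico (switchTime T σ j) (switchTime T σ (j + 1)) ×ˢ ball x' r, F q
        ≤ ∫⁻ q in Ico (switchTime T σ j) (switchTime T σ (j + 1)) ×ˢ ball x' r,
            ENNReal.ofReal ((a ^ j * (τ⁻¹) ^ j) ^ 2 * M₁) :=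
          setLIntegral_mono' (measurableSet_Ico.prod measurableSet_ball) hj'
      _ = ENNReal.ofReal ((a ^ j * (τ⁻¹) ^ j) ^ 2 * M₁) *
            volume (Ico (switchTime T σ j) (switchTime T σ (j + 1)) ×ˢ ball x' r) := setLIntegral_const _ _
      _ = ENNReal.ofReal (M₁ * T * V₁ * (r ^ ((1 - ρ) + (2 + ρ)) * (τ ^ j) ^ (-(2 + ρ)))) := by
          rw [hvol, hr3, ← hcoef, ← ENNReal.ofReal_mul (pow_nonneg hr.le 3),
            ← ENNReal.ofReal_mul (mul_nonneg h.T_pos.le (pow_nonneg h.σ_pos.le _)),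
            ← ENNReal.ofReal_mul (mul_nonneg (sq_nonneg _) hM₁0)]
          congr 1; ring

/-- **The power-weighted `E`-gauge of the cascade is bounded at every centre and scale**:
`r^{ρ} · E(r; z₀) ≤ C` with `E = cknE` (`r⁻¹ ∫∫_{Q_r(z₀)} |D𝔲|²`, `Q_r(z₀) ⊆ ℝ × B_r`) — Seregin's
second gauge (arXiv:2402.13229, (1.7)) for the NSI cascade and its slice derivative. [folklore] -/
theorem exists_powerGaugeE_le (h : IsSuperBlock T ν₀ τ σ a z G u) (hρ : a = τ ^ (-(1 + ρ))) :
    ∃ C : ℝ, 0 ≤ C ∧ ∀ (z₀ : ℝ × EuclideanSpace ℝ (Fin 3)) (r : ℝ), 0 < r →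
      ENNReal.ofReal (r ^ ρ) * cknE r z₀ (fun s x => fderiv ℝ (glueG T σ τ a z u s) x) ≤
        ENNReal.ofReal C := by
  obtain ⟨C, hC0, hC⟩ := h.exists_lintegral_cylinder_frobeniusNormSq_le hρ
  refine ⟨C, hC0, fun z₀ r hr => ?_⟩
  have hcyl : ∫⁻ q in parabolicCylinder r z₀,
      ENNReal.ofReal (frobeniusNormSq (fderiv ℝ (glueG T σ τ a z u q.1) q.2)) ≤
        ENNReal.ofReal (C * r ^ (1 - ρ)) :=
    (lintegral_mono_set (prod_mono (subset_univ _) Subset.rfl)).trans (hC z₀.2 r hr)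
  calc ENNReal.ofReal (r ^ ρ) * cknE r z₀ (fun s x => fderiv ℝ (glueG T σ τ a z u s) x)
      ≤ ENNReal.ofReal (r ^ ρ) * ((ENNReal.ofReal r)⁻¹ * ENNReal.ofReal (C * r ^ (1 - ρ))) :=
        mul_le_mul' le_rfl (mul_le_mul' le_rfl hcyl)
    _ = ENNReal.ofReal (r ^ ρ * (r⁻¹ * (C * r ^ (1 - ρ)))) := by
        rw [← ENNReal.ofReal_inv_of_pos hr, ← ENNReal.ofReal_mul (inv_pos.2 hr).le,
          ← ENNReal.ofReal_mul (by positivity)]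
    _ = ENNReal.ofReal C := by
        congr 1
        rw [show r ^ ρ * (r⁻¹ * (C * r ^ (1 - ρ))) = C * (r ^ ρ * r ^ (1 - ρ) * r⁻¹) by ring,
          ← Real.rpow_add hr, ← Real.rpow_neg_one, ← Real.rpow_add hr]
        norm_num

end IsSuperBlock

end Summit.NavierStokesRegularity.NavierStokesRegularity.Theorems.TypeIliouvilleNoTypeIINegative

end
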